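import Summits.QuantumFields.YangMills.Theorems.UnitScaleTiltCurvGradAxialFlat
import Literature.MathematicalPhysics.QuantumFieldTheory.Balaban1983to89.T3CurvGradLog
import HarnessLib

/-!
# Route `UnitScaleTilt`, crux K1 child «MinimiserStabilityRegPr» (stmt-QuantumFields-19200), reshape v6 — **STUB V4′
# `stub_critCurvGradLog` PROVED**: the log-Lipschitz curvature-gradient bound holds for EVERY (8)-regular configuration

Cell `ym3-torus` (HUMAN RULING D-0037, YM ladder rung R3), seat `ym3-torus-p1` gen 13 (UV side); memo HOME/UV3-NODE.md §22.

THE THEOREM (`regPr_curvGrad_lt`).  For `L > 1` and `B₃ > 0` there are `a₁ = 1/B₃` and `B₄` such that for every member `F` of the `T³`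
family with block size `L`, all heights `n < K`, `0 < ε₁ ≤ a₁` and EVERY configuration `U` of the finest lattice in print's regular space (8)
(`RegPr F n K (B₃ε₁) U`: plaquettes `< B₃ε₁L^{−2(K−n)}`, covariant divergence `< B₃ε₁L^{−3(K−n)}`), every backward covariant derivative of
every plaquette field satisfies `‖(D^{1*}_{U,ν}F_{κκ′})(x)‖ < B₄·ε₁·((K−n)+1)·L^{−3(K−n)}`.  NO criticality, NO minimisation, NO
constraint structure — so the v6 stub `stub_critCurvGradLog : ∀ L>1 ∀ B₃>4 ∃ a₁ B₄>0, CritCurvGradLogAt L a₁ B₃ B₄` (reading (9) of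
[Balaban1985Variational] for critical configurations in (8) with the log-Lipschitz rate) follows by weakening.

PROOF.  Pull the configuration back to the universal cover based at `x` (tree `B10Eq27TorusAxialLog.pull`, dictionary `covDeriv_pull`,
`plaqF_pull`, `covDiv_pull` of `B10Eq68TorusRegularity`); apply the `ℤ³` theorem `…CurvGradAxialFlat.norm_covDeriv_plaqF_le` (complete
axial gauge + lattice Bianchi + the flat divergence-form log-Lipschitz estimate = discrete Calderón–Zygmund endpoint on the Green kernel of
`ℤ³`) with `a = B₃ε₁η²`, `b = B₃ε₁η³`, `R = 2L^{K−n} = 2/η`: `(1 + log R)(b + Ra² + a/R) ≤ (2 + L)((K−n)+1)·(7/2)B₃ε₁η³`.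
This is the cell's finding F-g12-1 made a theorem: the `β₀ = 1` reading of (9) fails exactly by the logarithm `Σ_{1≤|y|≤R}|y|^{−3}`, and the
logarithm is all that fails — for all of (8), not only for minimisers.

References: T. Bałaban, CMP 102 (1985) 277–309 [Balaban1985Variational] Thm 1 (9) p.279, (2)/(8) pp.278–279; CMP 99 (1985) 75–102
[Balaban1985RegularSpaces] (1.1)–(1.2), Thm 2 (1.36) p.82; G. F. Lawler, V. Limic (2010) Thm 4.3.1 (Green kernel bounds, tree).
No sorry, standard axioms.  NOT a claim about the mass gap.
-/

set_option autoImplicit false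

noncomputable section

open scoped Matrix.Norms.L2Operator
open Literature.MathematicalPhysics.QuantumFieldTheory.Balaban1983to89
open Literature.MathematicalPhysics.QuantumFieldTheory.Balaban1983to89.T3ContinuumYM3Torus
open Literature.MathematicalPhysics.QuantumFieldTheory.Balaban1983to89.T3RegularMinimiser
open Literature.MathematicalPhysics.QuantumFieldTheory.Balaban1983to89.T3PrintedRegularMinimiser
open Literature.MathematicalPhysics.QuantumFieldTheory.Balaban1983to89.T3CurvGradLog (CritCurvGradLogAt)
open B10Eq27TorusAxialLog (toUField unitsField pull pull_apply transl transl_zero hol_pull unitsField_mem_unitaryUnits U1_of_unitaryUnits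
  norm_holT_unitsField_plaqWord_sub_one dist1_plaqHol_toUField)
open B10Eq68TorusRegularity (plaqFT covDerivT covDivT plaqF_pull covDeriv_pull covDiv_pull)
open B8Ineq132 (plaqF covDeriv covDiv)
open B7Prop1Explicit (hol plaqWord U1 hol_mem norm_inv_sub_one_le)
open Summit.QuantumFields.YangMills.Theorems.CurvGradAxial (norm_covDeriv_plaqF_le hol_plaqWord_swap)

namespace Summit.QuantumFields.YangMills.Theorems.CritCurvGradLog

/-- A member of the family has block size `L ≥ 3` (`L` odd and `> 1`). [cite: Balaban1985UV3, (1)-(3) p.256] -/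
theorem three_le_L (F : T3Family) : 3 ≤ F.L := by
  obtain ⟨m, hm⟩ := F.hL.1; have := F.hL.2; omega

/-- **THE CURVATURE GRADIENT OF EVERY (8)-REGULAR CONFIGURATION IS LOG-LIPSCHITZ SMALL**: for `L > 1`, `B₃ > 0` there are `a₁, B₄ > 0`
with `‖(D^{1*}_{U,ν}F_{κκ′})(x)‖ < B₄ε₁((K−n)+1)L^{−3(K−n)}` for every `F` with `F.L = L`, `n < K`, `0 < ε₁ ≤ a₁` and every `U` with
`RegPr F n K (B₃ε₁) U` — all points `x` and all index triples. [cite: Balaban1985Variational, Thm 1 (9) p.279; Balaban1985RegularSpaces, (1.1)-(1.2) p.76] -/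
theorem regPr_curvGrad_lt (L : ℕ) (hL : 1 < L) (B₃ : ℝ) (hB₃ : 0 < B₃) :
    ∃ a₁ B₄ : ℝ, 0 < a₁ ∧ 0 < B₄ ∧ ∀ F : T3Family, F.L = L → ∀ (n K : ℕ), n < K → ∀ ε₁ : ℝ, 0 < ε₁ → ε₁ ≤ a₁ →
      ∀ U : GaugeField (F.P K) 0 (Matrix.specialUnitaryGroup (Fin 2) ℂ), RegPr F n K (B₃ * ε₁) U →
        ∀ (x : Site (F.P K) 0) (ν κ κ' : Fin (F.P K).d),
          ‖covDerivT 1 (unitsField (toUField U)) ν (plaqFT (unitsField (toUField U)) κ κ') x‖ <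
            B₄ * ε₁ * (((K - n : ℕ) : ℝ) + 1) * ((F.L : ℝ)⁻¹) ^ (3 * (K - n)) := by
  obtain ⟨C, hC, hmain⟩ := norm_covDeriv_plaqF_le (d := 3) (𝔸 := Matrix (Fin 2) (Fin 2) ℂ) le_rfl
  refine ⟨1 / B₃, 4 * C * (2 + L) * B₃ + 1, by positivity, by positivity, fun F hF n K hnK ε₁ hε₁ hε₁a U hU x ν κ κ' => ?_⟩
  have hL1 : (1 : ℝ) < L := by exact_mod_cast hL
  have hL3 : 3 ≤ F.L := three_le_L F
  have hLr : (3 : ℝ) ≤ (F.L : ℝ) := by exact_mod_cast hL3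
  have hL0 : (0 : ℝ) < F.L := by linarith
  -- letters: `η = L^{-(K-n)}`, `a`, `b`, `R = 2L^{K-n}`
  set η : ℝ := ((F.L : ℝ)⁻¹) ^ (K - n) with hη
  have hη0 : 0 < η := pow_pos (inv_pos.2 hL0) _
  have hη1 : η ≤ 1 := pow_le_one₀ (inv_nonneg.2 hL0.le) (inv_le_one_of_one_le₀ (by linarith))
  have hpow2 : ((F.L : ℝ)⁻¹) ^ (2 * (K - n)) = η ^ 2 := by rw [hη, ← pow_mul, mul_comm]
  have hpow3 : ((F.L : ℝ)⁻¹) ^ (3 * (K - n)) = η ^ 3 := by rw [hη, ← pow_mul, mul_comm]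
  have hBε : B₃ * ε₁ ≤ 1 := by
    have := mul_le_mul_of_nonneg_left hε₁a hB₃.le; rwa [mul_one_div_cancel hB₃.ne'] at this
  have hBε0 : 0 < B₃ * ε₁ := mul_pos hB₃ hε₁
  set a : ℝ := B₃ * ε₁ * η ^ 2 with ha
  set b : ℝ := B₃ * ε₁ * η ^ 3 with hb
  have ha0 : 0 ≤ a := by positivity
  have ha1 : a ≤ 1 := by
    rw [ha]; calc B₃ * ε₁ * η ^ 2 ≤ 1 * 1 := mul_le_mul hBε (pow_le_one₀ hη0.le hη1) (by positivity) zero_le_one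
      _ = 1 := one_mul 1
  set R : ℕ := 2 * F.L ^ (K - n) with hR
  have hLK : F.L ≤ F.L ^ (K - n) := by
    calc F.L = F.L ^ 1 := (pow_one _).symm
      _ ≤ F.L ^ (K - n) := Nat.pow_le_pow_right (by omega) (by omega)
  have hR4 : 4 ≤ R := by rw [hR]; omega
  have hRη : (R : ℝ) * η = 2 := by
    rw [hR, hη]; push_cast
    rw [inv_pow, mul_assoc, mul_inv_cancel₀ (pow_ne_zero _ hL0.ne'), mul_one]
  have hRpos : (0 : ℝ) < R := by exact_mod_cast (show 0 < R by omega)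
  -- the pulled-back configuration on `ℤ³`
  set Ut := unitsField (toUField U) with hUt
  set V := pull Ut x with hV
  have hVm : ∀ z k, V z k ∈ U1 (Matrix (Fin 2) (Fin 2) ℂ) := by
    letI : CStarAlgebra (Matrix (Fin 2) (Fin 2) ℂ) := B10Eq29TubeLine.cstarAlgebraMatrix 2
    exact fun z k => U1_of_unitaryUnits (fun b => unitsField_mem_unitaryUnits (toUField U) b) ⟨transl x z, k⟩
  have hPl : ∀ z (κ₁ μ₁ : Fin (F.P K).d), κ₁ ≠ μ₁ → ‖plaqF V κ₁ μ₁ z - 1‖ ≤ a := by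
    -- positively oriented plaquettes: (13) as typed; the other orientation is the inverse holonomy
    have hpos : ∀ z (κ₁ μ₁ : Fin (F.P K).d) (h : κ₁ < μ₁), ‖plaqF V κ₁ μ₁ z - 1‖ ≤ a := by
      intro z κ₁ μ₁ h
      have e1 : plaqF V κ₁ μ₁ z = ((hol V z (plaqWord κ₁ μ₁) : (Matrix (Fin 2) (Fin 2) ℂ)ˣ) : Matrix (Fin 2) (Fin 2) ℂ) := rfl
      rw [e1, hV, hol_pull, hUt, norm_holT_unitsField_plaqWord_sub_one (toUField U) _ h, dist1_plaqHol_toUField]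
      have := hU.1 ⟨transl x z, κ₁, μ₁, h⟩
      rw [regThreshold, hpow2] at this
      exact this.le
    intro z κ₁ μ₁ hne
    rcases lt_or_gt_of_ne hne with hlt | hgt
    · exact hpos z κ₁ μ₁ hlt
    · have e1 : plaqF V κ₁ μ₁ z = (((hol V z (plaqWord μ₁ κ₁))⁻¹ : (Matrix (Fin 2) (Fin 2) ℂ)ˣ) : Matrix (Fin 2) (Fin 2) ℂ) := by
        show ((hol V z (plaqWord κ₁ μ₁) : (Matrix (Fin 2) (Fin 2) ℂ)ˣ) : Matrix (Fin 2) (Fin 2) ℂ) = _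
        rw [hol_plaqWord_swap V μ₁ κ₁ z]
      rw [e1]
      exact (norm_inv_sub_one_le (hol_mem hVm z _)).trans (hpos z μ₁ κ₁ hgt)
  have hDv : ∀ z (μ₁ : Fin (F.P K).d), ‖covDiv 1 V μ₁ z‖ ≤ b := by
    intro z μ₁
    rw [hV, covDiv_pull]
    have := hU.2 ⟨transl x z, μ₁⟩
    rw [hpow3] at this
    exact this.le
  have key := hmain R hR4 V hVm a b ha0 ha1 hPl hDv ν κ κ'
  -- the dictionary for the target
  have htarget : covDerivT 1 Ut ν (plaqFT Ut κ κ') x = covDeriv 1 V ν (plaqF V κ κ') 0 := by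
    have h1 := covDeriv_pull 1 Ut x ν (plaqFT Ut κ κ') 0
    rw [transl_zero] at h1
    rw [← h1, hV]
    congr 1
    funext z'
    exact (plaqF_pull Ut x κ κ' z').symm
  rw [htarget]
  refine key.trans_lt ?_
  -- arithmetic: `(1 + log R)(b + Ra² + a/R) ≤ (2 + L)((K−n)+1)·(7/2)·B₃ε₁η³ < B₄ ε₁ ((K−n)+1) η³`
  rw [hpow3]
  have hsum : b + R * a ^ 2 + a / R ≤ 7 / 2 * (B₃ * ε₁) * η ^ 3 := by
    have h1 : (R : ℝ) * a ^ 2 = 2 * (B₃ * ε₁) * ((B₃ * ε₁) * η ^ 3) := by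
      rw [ha]; calc (R : ℝ) * (B₃ * ε₁ * η ^ 2) ^ 2 = (R * η) * (B₃ * ε₁) * ((B₃ * ε₁) * η ^ 3) := by ring
        _ = 2 * (B₃ * ε₁) * ((B₃ * ε₁) * η ^ 3) := by rw [hRη]
    have h2 : a / R = (B₃ * ε₁) * η ^ 3 / 2 := by
      rw [ha, eq_div_iff two_ne_zero, div_mul_eq_mul_div, div_eq_iff hRpos.ne']
      calc B₃ * ε₁ * η ^ 2 * 2 = B₃ * ε₁ * η ^ 2 * (R * η) := by rw [hRη]
        _ = B₃ * ε₁ * η ^ 3 * R := by ring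
    have h3 : 2 * (B₃ * ε₁) * ((B₃ * ε₁) * η ^ 3) ≤ 2 * 1 * ((B₃ * ε₁) * η ^ 3) :=
      mul_le_mul_of_nonneg_right (mul_le_mul_of_nonneg_left hBε zero_le_two) (by positivity)
    rw [h1, h2, hb]; linarith
  have hlog : 1 + Real.log R ≤ (2 + L) * ((((K - n : ℕ) : ℝ)) + 1) := by
    have hRr : (R : ℝ) = 2 * (F.L : ℝ) ^ (K - n) := by rw [hR]; push_cast; ring
    rw [hRr, Real.log_mul two_ne_zero (pow_ne_zero _ hL0.ne'), Real.log_pow, hF]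
    have h2 : Real.log 2 ≤ 1 := by have := Real.log_le_sub_one_of_pos (show (0:ℝ) < 2 by norm_num); linarith
    have hlogL : Real.log L ≤ L := by have := Real.log_le_sub_one_of_pos (show (0:ℝ) < L by linarith); linarith
    have hlogL0 : 0 ≤ Real.log L := Real.log_nonneg hL1.le
    have hk0 : (0 : ℝ) ≤ ((K - n : ℕ) : ℝ) := Nat.cast_nonneg _
    nlinarith [mul_le_mul_of_nonneg_left hlogL hk0]
  have hlog0 : 0 ≤ 1 + Real.log R := by
    have : 0 ≤ Real.log R := Real.log_nonneg (by exact_mod_cast (show 1 ≤ R by omega)); linarith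
  have hk1 : (0 : ℝ) < ((K - n : ℕ) : ℝ) + 1 := by positivity
  calc C * (1 + Real.log R) * (b + R * a ^ 2 + a / R)
      ≤ C * ((2 + L) * ((((K - n : ℕ) : ℝ)) + 1)) * (7 / 2 * (B₃ * ε₁) * η ^ 3) := by
        refine mul_le_mul (mul_le_mul_of_nonneg_left hlog hC.le) hsum (by positivity) (by positivity)
    _ < (4 * C * (2 + L) * B₃ + 1) * ε₁ * ((((K - n : ℕ) : ℝ)) + 1) * η ^ 3 := by
        have hpos : 0 < ε₁ * ((((K - n : ℕ) : ℝ)) + 1) * η ^ 3 := by positivity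
        have hC2 : 0 < C * (2 + (L : ℝ)) * B₃ := by positivity
        nlinarith

/-- **STUB V4′ OF THE v6 RESHAPE, BY NAME**: `∀ L > 1, ∀ B₃ > 4, ∃ a₁ B₄ > 0, CritCurvGradLogAt L a₁ B₃ B₄` — the log-Lipschitz form of
[Balaban1985Variational] Thm 1 (9) for critical configurations in (8), a special case of `regPr_curvGrad_lt` (the criticality, fibre and
datum hypotheses are not used). [cite: Balaban1985Variational, Thm 1 (9) p.279; Balaban1985RegularSpaces, Thm 2 (1.36) p.82] -/
theorem stub_critCurvGradLog : ∀ (L : ℕ), 1 < L → ∀ B₃ : ℝ, 4 < B₃ → ∃ a₁ B₄ : ℝ, 0 < a₁ ∧ 0 < B₄ ∧ CritCurvGradLogAt L a₁ B₃ B₄ := by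
  intro L hL B₃ hB₃
  obtain ⟨a₁, B₄, ha₁, hB₄, h⟩ := regPr_curvGrad_lt L hL B₃ (by linarith)
  exact ⟨a₁, B₄, ha₁, hB₄, fun F hF n K hnK ε₁ hε₁ hε₁a _ _ U hU8 _ _ x ν κ κ' _ => h F hF n K hnK ε₁ hε₁ hε₁a U hU8 x ν κ κ'⟩

end Summit.QuantumFields.YangMills.Theorems.CritCurvGradLog

end
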